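import Summits.BirchSwinnertonDyer.Rank1Residual.GaloisImage.LagrangianComplementDichotomy
import Mathlib.LinearAlgebra.BilinearForm.Orthogonal
import Mathlib.LinearAlgebra.Dimension.Free
import Mathlib.Tactic.LinearCombination
import Mathlib.Tactic.Ring
import HarnessLib

/-!
# The three-Lagrangian lemma, IV: the RULING LAW — Lagrangians meeting a fixed Lagrangian `W` in a
# line (r1 ROUTE-1 §44.6 ST-44e (R2)/(R3), "L44-bis": the two rulings of the split quadric surface)
# (cell `b2b-bsdres`, team n1011, seat p02 gen 9 — TOOL file; row T-K43-TOOL tail; lead R5-87 (a)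
# "ST-44e STAYS WITH p02"; referee-1 GEN 36 proviso (iv); skeleton `cells/n1011/skel/T-K43.md` §4)

HONEST FRAMING (cell `b2b-bsdres`, run/shared/lean/b2b/bsd-rank1-residual/, verbatim in every
file): the goal of the cell is to DELETE the COMBINATION-SHAPED residual classes of the
Birch–Swinnerton-Dyer formula for ALL analytic-rank `≤ 1` elliptic curves over `ℚ` — "full BSD
formula for every rank `≤ 1` curve in class `C`" assembled STRICTLY from published theorems — so
that the rank-`≤ 1` remainder becomes exactly the CONSTRUCTION-SHAPED classes, which are TYPED
(missing-input `Prop`s), NOT attempted. This is not "finishing BSD". Team n1011 (N10 / N11, the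
additive block `X4 ∧ p = 3`): research route; no claim beyond the stated classes; labels UNCHANGED;
nothing is booked. Theorems only (no definition, no named fact); a TOOL file of pure linear algebra
in the currency of PART A (`LagrangianComplementDichotomy.lean`, p12 p311626: `[NeZero (2 : K)]`,
`hB : B.Nondegenerate`, `hBs : B.IsSymm`, "isotropic `L`" = `∀ x ∈ L, ∀ y ∈ L, B x y = 0`).

## What (the geometry: the eight Lagrangian planes of `𝔽₃⁴` are the two reguli of the quadric)

In a `4`-space `V` with a symmetric non-degenerate bilinear form over a field with `2 ≠ 0`, fix an
isotropic `2`-plane `W`. PART A / files I–III treat the isotropic `2`-planes TRANSVERSE to `W`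
(`W`'s own ruling minus `W`). This file treats the OTHER ruling — the isotropic `2`-planes meeting
`W` in a LINE — and proves r1's ST-44e:

* §1 `inf_eq_span_singleton_of_ne` — any two DISTINCT `2`-planes through `w₀ ≠ 0` meet exactly in
  `K ∙ w₀`; `eq_span_singleton_of_mem_of_ne` — a proper subspace of a `2`-plane containing `w₀ ≠ 0`
  is `K ∙ w₀`; `orthogonal_eq_self_of_isotropic` — an isotropic `2`-plane of a non-degenerate
  `4`-space is its own orthogonal (`W^⊥ = W`).
* §2 **`eq_or_eq_of_isotropic_of_mem`** (THREE-PLANES LEMMA) — three isotropic `2`-planes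
  `L, M, N` through a common `w₀ ≠ 0` with `L ≠ M` satisfy `N = L ∨ N = M` (the plane
  `w₀^⊥ / K w₀` is hyperbolic with exactly two isotropic lines; proved inside `w₀^⊥ = L ⊔ M` with
  Mathlib's `LinearMap.BilinForm.orthogonal_orthogonal`, no quotient).
* §3 **(R2) `finrank_inf_eq_one_of_finrank_inf_eq_one_of_inf_eq_bot`** — `dim (L ⊓ W) = 1` and
  `L' ⊓ W = ⊥` ⟹ `dim (L ⊓ L') = 1` (opposite rulings meet in a line);
  **(R3) `inf_eq_bot_of_finrank_inf_eq_one_of_ne`** — `dim (L ⊓ W) = dim (L' ⊓ W) = 1`, `L ≠ L'`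
  ⟹ `L ⊓ L' = ⊥` (same ruling: disjoint), and **`eq_iff_inf_eq_inf_of_finrank_inf_eq_one`** —
  `dim (L ⊓ W) = dim (L' ⊓ W) = 1` ⟹ (`L = L' ↔ L ⊓ W = L' ⊓ W`).

r1's reading (ROUTE-1 §44 L44-bis, EVIDENCE there, THEOREM-SHAPE here): with `A(E) := dim(L_E ∩ Π)`
the cost table GG(1,0) = 1, GG(1,1) equal traces ⇒ 0, distinct ⇒ 2 follows from (R2)/(R3); the
cohomological inputs stay OUTSIDE this file (files III / records). Print anchor (n1011-lit GEN 19):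
Hirschfeld–Thas, *General Galois Geometries* (2016) §1.4 Thm 1.39 / Cor 1.40 (ii) — the two systems
of generators; nothing of it is transcribed, the statements below are proved from scratch.
-/

open Module Submodule

namespace Summit.BirchSwinnertonDyer.Rank1Residual.GaloisImage.ThreeLagrangian

variable {K V : Type*} [Field K] [AddCommGroup V] [Module K V]

/-! ## §1 Planes through a common vector; `W^⊥ = W` -/

section Planes

/-- A subspace of a `2`-plane `M` containing `w₀ ≠ 0` and different from `M` is the line `K ∙ w₀`.
[folklore] -/
theorem eq_span_singleton_of_mem_of_ne {M S : Submodule K V} (hM2 : finrank K M = 2) (hSM : S ≤ M)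
    (hne : S ≠ M) {w₀ : V} (hw₀ : w₀ ≠ 0) (hwS : w₀ ∈ S) : S = K ∙ w₀ := by
  haveI : Module.Finite K M := Module.finite_of_finrank_eq_succ hM2
  have hlt : S < M := lt_of_le_of_ne hSM hne
  have hS : finrank K S < 2 := hM2 ▸ Submodule.finrank_lt_finrank_of_lt hlt
  have hle : (K ∙ w₀) ≤ S := (Submodule.span_singleton_le_iff_mem w₀ S).mpr hwS
  haveI : Module.Finite K S := Module.Finite.of_injective (Submodule.inclusion hSM)
    (Submodule.inclusion_injective hSM)
  have h1 : 1 ≤ finrank K S := by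
    have := Submodule.finrank_mono hle
    rwa [finrank_span_singleton hw₀] at this
  refine (Submodule.eq_of_le_of_finrank_eq hle ?_).symm
  rw [finrank_span_singleton hw₀]
  omega

/-- Two DISTINCT `2`-planes through `w₀ ≠ 0` meet exactly in the line `K ∙ w₀`. [folklore] -/
theorem inf_eq_span_singleton_of_ne {L M : Submodule K V} (hL2 : finrank K L = 2)
    (hM2 : finrank K M = 2) (hne : L ≠ M) {w₀ : V} (hw₀ : w₀ ≠ 0) (hwL : w₀ ∈ L) (hwM : w₀ ∈ M) :
    L ⊓ M = K ∙ w₀ := by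
  haveI : Module.Finite K M := Module.finite_of_finrank_eq_succ hM2
  refine eq_span_singleton_of_mem_of_ne hL2 inf_le_left (fun h ↦ hne ?_) hw₀ ⟨hwL, hwM⟩
  -- `L ⊓ M = L` gives `L ≤ M`, hence `L = M` by dimension
  exact Submodule.eq_of_le_of_finrank_eq (inf_eq_left.mp h) (hL2.trans hM2.symm)

variable (B : LinearMap.BilinForm K V)

/-- An isotropic subspace lies in its orthogonal. [folklore] -/
theorem le_orthogonal_of_isotropic {W : Submodule K V} (hW : ∀ x ∈ W, ∀ y ∈ W, B x y = 0) :
    W ≤ B.orthogonal W := fun x hx ↦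
  (LinearMap.BilinForm.mem_orthogonal_iff).mpr fun y hy ↦ hW y hy x hx

/-- **A Lagrangian is its own orthogonal**: an isotropic `2`-plane `W` of a non-degenerate
`4`-space satisfies `W^⊥ = W` (`W ≤ W^⊥` and `dim W^⊥ = 4 − 2`). [folklore] -/
theorem orthogonal_eq_self_of_isotropic [FiniteDimensional K V] (hB : B.Nondegenerate)
    (h4 : finrank K V = 4) {W : Submodule K V} (hW2 : finrank K W = 2)
    (hW : ∀ x ∈ W, ∀ y ∈ W, B x y = 0) : B.orthogonal W = W := by
  refine (Submodule.eq_of_le_of_finrank_eq (le_orthogonal_of_isotropic B hW) ?_).symm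
  rw [LinearMap.BilinForm.finrank_orthogonal hB, h4, hW2]

/-- For an isotropic `L ∋ w₀`: `L ≤ (K ∙ w₀)^⊥`. [folklore] -/
theorem le_orthogonal_span_singleton_of_isotropic {L : Submodule K V}
    (hL : ∀ x ∈ L, ∀ y ∈ L, B x y = 0) {w₀ : V} (hwL : w₀ ∈ L) : L ≤ B.orthogonal (K ∙ w₀) := by
  intro x hx
  rw [LinearMap.BilinForm.mem_orthogonal_iff]
  intro n hn
  obtain ⟨a, rfl⟩ := Submodule.mem_span_singleton.mp hn
  rw [map_smul, LinearMap.smul_apply, hL _ hwL _ hx, smul_zero]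

end Planes

/-! ## §2 The three-planes lemma (two isotropic lines in `w₀^⊥ / K w₀`) -/

section ThreePlanes

variable (B : LinearMap.BilinForm K V)

/-- **THREE-PLANES LEMMA.** Over a field with `2 ≠ 0`, in a `4`-space with a symmetric
non-degenerate bilinear form, let `L, M, N` be isotropic `2`-planes through a common `w₀ ≠ 0` with
`L ≠ M`. Then `N = L` or `N = M`. (Inside `P := (K w₀)^⊥ = L ⊔ M` — dimensions `3 = 2 + 2 − 1` —
pick `c ∈ N ∖ K w₀` and write `c = l + m`; `B c c = 0` gives `B l m = 0`; if `m ∉ K w₀` then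
`l ⊥ M`, `l ⊥ L`, so `l ∈ P^⊥ = K w₀` and `c ∈ M`; else `c ∈ L`; either way `N` shares the plane
`span {w₀, c}` with `L` or `M`.) [folklore] -/
theorem eq_or_eq_of_isotropic_of_mem [NeZero (2 : K)] (hB : B.Nondegenerate) (hBs : B.IsSymm)
    (h4 : finrank K V = 4) {L M N : Submodule K V} (hL2 : finrank K L = 2)
    (hM2 : finrank K M = 2) (hN2 : finrank K N = 2) (hL : ∀ x ∈ L, ∀ y ∈ L, B x y = 0)
    (hM : ∀ x ∈ M, ∀ y ∈ M, B x y = 0) (hN : ∀ x ∈ N, ∀ y ∈ N, B x y = 0) {w₀ : V}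
    (hw₀ : w₀ ≠ 0) (hwL : w₀ ∈ L) (hwM : w₀ ∈ M) (hwN : w₀ ∈ N) (hLM : L ≠ M) :
    N = L ∨ N = M := by
  haveI : FiniteDimensional K V := Module.finite_of_finrank_eq_succ h4
  haveI : Module.Finite K N := Module.finite_of_finrank_eq_succ hN2
  -- `L ⊓ M = K w₀`, `dim (L ⊔ M) = 3`, `L ⊔ M = (K w₀)^⊥ =: P`
  have hLM1 : L ⊓ M = K ∙ w₀ := inf_eq_span_singleton_of_ne hL2 hM2 hLM hw₀ hwL hwM
  have hsup3 : finrank K ↥(L ⊔ M) = 3 := by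
    have h := Submodule.finrank_sup_add_finrank_inf_eq L M
    rw [hLM1, finrank_span_singleton hw₀, hL2, hM2] at h
    omega
  have hP : B.orthogonal (K ∙ w₀) = L ⊔ M := by
    refine (Submodule.eq_of_le_of_finrank_eq (sup_le
      (le_orthogonal_span_singleton_of_isotropic B hL hwL)
      (le_orthogonal_span_singleton_of_isotropic B hM hwM)) ?_).symm
    rw [hsup3, LinearMap.BilinForm.finrank_orthogonal hB, h4, finrank_span_singleton hw₀]
  -- a second generator `c` of `N`
  have hwN' : (K ∙ w₀) < N := by
    refine lt_of_le_of_ne ((Submodule.span_singleton_le_iff_mem w₀ N).mpr hwN) fun h ↦ ?_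
    have := congrArg (fun S : Submodule K V ↦ finrank K S) h
    simp only [finrank_span_singleton hw₀, hN2] at this
    omega
  obtain ⟨c, hcN, hcw⟩ := SetLike.exists_of_lt hwN'
  -- the key step: `c ∈ L` or `c ∈ M`
  have hcP : c ∈ L ⊔ M := hP ▸ le_orthogonal_span_singleton_of_isotropic B hN hwN hcN
  obtain ⟨l, hl, m, hm, hlm⟩ := Submodule.mem_sup.mp hcP
  have hBlm : B l m = 0 := by
    have hcc : B c c = 0 := hN c hcN c hcN
    rw [← hlm] at hcc
    simp only [map_add, LinearMap.add_apply] at hcc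
    rw [hL l hl l hl, hM m hm m hm, hBs.eq m l, zero_add, add_zero, ← two_mul, mul_eq_zero] at hcc
    exact hcc.resolve_left (NeZero.ne 2)
  have hcLM : c ∈ L ∨ c ∈ M := by
    by_cases hmw : m ∈ K ∙ w₀
    · -- `c = l + a w₀ ∈ L`
      left
      rw [← hlm]
      exact L.add_mem hl ((Submodule.span_singleton_le_iff_mem w₀ L).mpr hwL hmw)
    · -- `l ⊥ M` (the subspace of `M` orthogonal to `l` contains `w₀` and `m ∉ K w₀`), `l ⊥ L`
      right
      have hlM : ∀ y ∈ M, B l y = 0 := by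
        let S : Submodule K V := M ⊓ B.orthogonal (K ∙ l)
        have hSM : S = M := by
          by_contra hne
          have hS : S = K ∙ w₀ := eq_span_singleton_of_mem_of_ne hM2 inf_le_left hne hw₀
            ⟨hwM, (LinearMap.BilinForm.mem_orthogonal_iff).mpr fun n hn ↦ by
              obtain ⟨a, rfl⟩ := Submodule.mem_span_singleton.mp hn
              rw [map_smul, LinearMap.smul_apply, hL l hl w₀ hwL, smul_zero]⟩
          have hmS : m ∈ S := ⟨hm, (LinearMap.BilinForm.mem_orthogonal_iff).mpr fun n hn ↦ by
            obtain ⟨a, rfl⟩ := Submodule.mem_span_singleton.mp hn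
            rw [map_smul, LinearMap.smul_apply, hBlm, smul_zero]⟩
          exact hmw (hS ▸ hmS)
        intro y hy
        have hyS : y ∈ S := hSM.symm ▸ hy
        have := (LinearMap.BilinForm.mem_orthogonal_iff).mp hyS.2 l (Submodule.mem_span_singleton_self l)
        exact this
      -- so `l ∈ P^⊥ = K w₀ ≤ M` and `c = l + m ∈ M`
      have hlP : l ∈ B.orthogonal (B.orthogonal (K ∙ w₀)) := by
        rw [hP, LinearMap.BilinForm.mem_orthogonal_iff]
        intro n hn
        obtain ⟨l', hl', m', hm', rfl⟩ := Submodule.mem_sup.mp hn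
        rw [map_add, LinearMap.add_apply, hL l' hl' l hl, hBs.eq m' l, hlM m' hm', zero_add]
      rw [LinearMap.BilinForm.orthogonal_orthogonal hB hBs.isRefl] at hlP
      rw [← hlm]
      exact M.add_mem ((Submodule.span_singleton_le_iff_mem w₀ M).mpr hwM hlP) hm
  -- conclude: `N` and `L` (resp. `M`) are two planes through `w₀` sharing `c ∉ K w₀`
  rcases hcLM with hcL | hcM
  · left
    by_contra hNL
    have := inf_eq_span_singleton_of_ne hN2 hL2 hNL hw₀ hwN hwL
    exact hcw (this ▸ (⟨hcN, hcL⟩ : c ∈ N ⊓ L))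
  · right
    by_contra hNM
    have := inf_eq_span_singleton_of_ne hN2 hM2 hNM hw₀ hwN hwM
    exact hcw (this ▸ (⟨hcN, hcM⟩ : c ∈ N ⊓ M))

end ThreePlanes

/-! ## §3 ST-44e: the ruling law (R2), (R3) -/

section Rulings

variable (B : LinearMap.BilinForm K V) {W L L' : Submodule K V}

/-- A `1`-dimensional `S` has a non-zero element, and it spans. [folklore] -/
theorem exists_ne_zero_eq_span_of_finrank_eq_one {S : Submodule K V} (h : finrank K S = 1) :
    ∃ w₀ : V, w₀ ≠ 0 ∧ w₀ ∈ S ∧ S = K ∙ w₀ := by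
  haveI : Module.Finite K S := Module.finite_of_finrank_eq_succ h
  obtain ⟨w₀, hw₀S, hw₀⟩ := (Submodule.ne_bot_iff S).mp (by
    rintro rfl
    rw [finrank_bot] at h
    exact zero_ne_one h)
  refine ⟨w₀, hw₀, hw₀S, Submodule.eq_of_le_of_finrank_eq
    ((Submodule.span_singleton_le_iff_mem w₀ S).mpr hw₀S) ?_ |>.symm⟩
  rw [finrank_span_singleton hw₀, h]

/-- **(R3), disjointness clause — the same ruling is pairwise disjoint.** Over a field with
`2 ≠ 0`, in a symmetric non-degenerate `4`-space, let `W, L, L'` be isotropic `2`-planes with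
`dim (L ⊓ W) = dim (L' ⊓ W) = 1` and `L ≠ L'`. Then `L ⊓ L' = ⊥`. (A non-zero `v ∈ L ∩ L'` lies
in `W` — then `W, L, L'` are three planes through `v`, so `W ∈ {L, L'}`, contradicting the
`1`-dimensional intersections — or not — then the lines `L ∩ W = K w₀`, `L' ∩ W = K w₀'` are both
`⊥ v`, and `W^⊥ = W ∌ v` forces `w₀' ∈ K w₀ ⊂ L'`, so `L ∩ L' ⊇ {w₀, v}` is a plane, `L = L'`.)
[folklore] -/
theorem inf_eq_bot_of_finrank_inf_eq_one_of_ne [NeZero (2 : K)] (hB : B.Nondegenerate)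
    (hBs : B.IsSymm) (h4 : finrank K V = 4) (hW2 : finrank K W = 2) (hL2 : finrank K L = 2)
    (hL'2 : finrank K L' = 2) (hW : ∀ x ∈ W, ∀ y ∈ W, B x y = 0)
    (hL : ∀ x ∈ L, ∀ y ∈ L, B x y = 0) (hL' : ∀ x ∈ L', ∀ y ∈ L', B x y = 0)
    (hLW : finrank K ↥(L ⊓ W) = 1) (hL'W : finrank K ↥(L' ⊓ W) = 1) (hne : L ≠ L') :
    L ⊓ L' = ⊥ := by
  haveI : FiniteDimensional K V := Module.finite_of_finrank_eq_succ h4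
  by_contra hbot
  obtain ⟨v, hv, hv0⟩ := (Submodule.ne_bot_iff _).mp hbot
  obtain ⟨w₀, hw₀, hw₀LW, hLWeq⟩ := exists_ne_zero_eq_span_of_finrank_eq_one hLW
  obtain ⟨w₀', hw₀', hw₀'LW, hL'Weq⟩ := exists_ne_zero_eq_span_of_finrank_eq_one hL'W
  by_cases hvW : v ∈ W
  · -- three planes `L, L', W` through `v`
    rcases eq_or_eq_of_isotropic_of_mem B hB hBs h4 hL2 hL'2 hW2 hL hL' hW hv0 hv.1 hv.2 hvW hne
      with h | h
    · rw [h, inf_idem, hL2] at hLW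
      exact absurd hLW (by decide)
    · rw [h, inf_idem, hL'2] at hL'W
      exact absurd hL'W (by decide)
  · -- `v ⊥ w₀, w₀'`; the part of `W` orthogonal to `v` is a proper subspace containing `w₀`
    have hvw₀ : B v w₀ = 0 := hL v hv.1 w₀ hw₀LW.1
    have hvw₀' : B v w₀' = 0 := hL' v hv.2 w₀' hw₀'LW.1
    let S : Submodule K V := W ⊓ B.orthogonal (K ∙ v)
    have hmemS : ∀ w ∈ W, B v w = 0 → w ∈ S := fun w hw hBvw ↦
      ⟨hw, (LinearMap.BilinForm.mem_orthogonal_iff).mpr fun n hn ↦ by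
        obtain ⟨a, rfl⟩ := Submodule.mem_span_singleton.mp hn
        rw [map_smul, LinearMap.smul_apply, hBvw, smul_zero]⟩
    have hSW : S ≠ W := by
      intro hSW
      -- then `v ⊥ W`, so `v ∈ W^⊥ = W`
      apply hvW
      rw [← orthogonal_eq_self_of_isotropic B hB h4 hW2 hW, LinearMap.BilinForm.mem_orthogonal_iff]
      intro w hw
      have hwS : w ∈ S := hSW.symm ▸ hw
      rw [hBs.eq]
      exact (LinearMap.BilinForm.mem_orthogonal_iff).mp hwS.2 v (Submodule.mem_span_singleton_self v)
    have hS : S = K ∙ w₀ :=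
      eq_span_singleton_of_mem_of_ne hW2 inf_le_left hSW hw₀ (hmemS w₀ hw₀LW.2 hvw₀)
    -- hence `w₀' ∈ K w₀`, so `w₀ ∈ L'`
    have hw₀'S : w₀' ∈ K ∙ w₀ := hS ▸ hmemS w₀' hw₀'LW.2 hvw₀'
    obtain ⟨a, ha⟩ := Submodule.mem_span_singleton.mp hw₀'S
    have ha0 : a ≠ 0 := by rintro rfl; exact hw₀' (by rw [← ha, zero_smul])
    have hw₀L' : w₀ ∈ L' := by
      have : w₀ = a⁻¹ • w₀' := by rw [← ha, smul_smul, inv_mul_cancel₀ ha0, one_smul]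
      rw [this]
      exact L'.smul_mem _ hw₀'LW.1
    -- `L ⊓ L' = K w₀` would contain `v ∉ K w₀`
    have hLL' := inf_eq_span_singleton_of_ne hL2 hL'2 hne hw₀ hw₀LW.1 hw₀L'
    have hvw : v ∈ K ∙ w₀ := hLL' ▸ hv
    obtain ⟨b, rfl⟩ := Submodule.mem_span_singleton.mp hvw
    exact hvW (W.smul_mem b hw₀LW.2)

/-- **(R3), equality clause — in the ruling opposite to `W` a Lagrangian is determined by its
trace on `W`.** Under `dim (L ⊓ W) = dim (L' ⊓ W) = 1`: `L = L' ↔ L ⊓ W = L' ⊓ W`. (If the traces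
agree, `L, L', W` are three isotropic planes through a generator `w₀` of the common trace; were
`L ≠ L'`, the three-planes lemma would give `W ∈ {L, L'}`, contradicting `dim (L ⊓ W) = 1`.)
[folklore] -/
theorem eq_iff_inf_eq_inf_of_finrank_inf_eq_one [NeZero (2 : K)] (hB : B.Nondegenerate)
    (hBs : B.IsSymm) (h4 : finrank K V = 4) (hW2 : finrank K W = 2) (hL2 : finrank K L = 2)
    (hL'2 : finrank K L' = 2) (hW : ∀ x ∈ W, ∀ y ∈ W, B x y = 0)
    (hL : ∀ x ∈ L, ∀ y ∈ L, B x y = 0) (hL' : ∀ x ∈ L', ∀ y ∈ L', B x y = 0)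
    (hLW : finrank K ↥(L ⊓ W) = 1) (hL'W : finrank K ↥(L' ⊓ W) = 1) :
    L = L' ↔ L ⊓ W = L' ⊓ W := by
  refine ⟨fun h ↦ by rw [h], fun h ↦ ?_⟩
  by_contra hne
  obtain ⟨w₀, hw₀, hw₀LW, -⟩ := exists_ne_zero_eq_span_of_finrank_eq_one hLW
  have hw₀L'W : w₀ ∈ L' ⊓ W := h ▸ hw₀LW
  rcases eq_or_eq_of_isotropic_of_mem B hB hBs h4 hL2 hL'2 hW2 hL hL' hW hw₀ hw₀LW.1 hw₀L'W.1
    hw₀LW.2 hne with hWL | hWL'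
  · rw [hWL, inf_idem, hL2] at hLW
    exact absurd hLW (by decide)
  · rw [hWL', inf_idem, hL'2] at hL'W
    exact absurd hL'W (by decide)

/-- **(R2) — opposite rulings meet in a line.** Over a field with `2 ≠ 0`, in a symmetric
non-degenerate `4`-space, let `W, L, L'` be isotropic `2`-planes with `dim (L ⊓ W) = 1` and
`L' ⊓ W = ⊥`. Then `dim (L ⊓ L') = 1`. (Let `K w₀ = L ∩ W`; the functional `B(·, w₀)` on the
plane `L'` has a non-zero kernel vector `x₀`; `N := span {w₀, x₀}` is an isotropic plane through
`w₀`, so by the three-planes lemma `N = L` or `N = W`; `x₀ ∉ W` excludes the latter, hence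
`x₀ ∈ L ∩ L'`; and `L ∩ L' ≠ L'` since `L'` misses `W` while `L` does not.) [folklore] -/
theorem finrank_inf_eq_one_of_finrank_inf_eq_one_of_inf_eq_bot [NeZero (2 : K)]
    (hB : B.Nondegenerate) (hBs : B.IsSymm) (h4 : finrank K V = 4) (hW2 : finrank K W = 2)
    (hL2 : finrank K L = 2) (hL'2 : finrank K L' = 2) (hW : ∀ x ∈ W, ∀ y ∈ W, B x y = 0)
    (hL : ∀ x ∈ L, ∀ y ∈ L, B x y = 0) (hL' : ∀ x ∈ L', ∀ y ∈ L', B x y = 0)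
    (hLW : finrank K ↥(L ⊓ W) = 1) (hL'W : L' ⊓ W = ⊥) :
    finrank K ↥(L ⊓ L') = 1 := by
  haveI : FiniteDimensional K V := Module.finite_of_finrank_eq_succ h4
  haveI : Module.Finite K L' := Module.finite_of_finrank_eq_succ hL'2
  obtain ⟨w₀, hw₀, hw₀LW, hLWeq⟩ := exists_ne_zero_eq_span_of_finrank_eq_one hLW
  have hLneW : L ≠ W := by
    intro h
    rw [h, inf_idem, hW2] at hLW
    exact absurd hLW (by decide)
  -- a non-zero `x₀ ∈ L'` with `B x₀ w₀ = 0`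
  let f : L' →ₗ[K] K := (LinearMap.flip B w₀) ∘ₗ L'.subtype
  have hker : LinearMap.ker f ≠ ⊥ :=
    LinearMap.ker_ne_bot_of_finrank_lt (by rw [Module.finrank_self, hL'2]; decide)
  obtain ⟨x₀', hx₀'ker, hx₀'0⟩ := (Submodule.ne_bot_iff _).mp hker
  set x₀ : V := (x₀' : V) with hx₀def
  have hx₀L' : x₀ ∈ L' := x₀'.2
  have hx₀0 : x₀ ≠ 0 := fun h ↦ hx₀'0 (Subtype.ext h)
  have hx₀w₀ : B x₀ w₀ = 0 := by
    have := LinearMap.mem_ker.mp hx₀'ker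
    simpa [f, LinearMap.flip_apply] using this
  have hx₀W : x₀ ∉ W := fun h ↦ hx₀0 ((Submodule.mem_bot K).mp (hL'W ▸ (⟨hx₀L', h⟩ : x₀ ∈ L' ⊓ W)))
  have hx₀w : x₀ ∉ K ∙ w₀ := fun h ↦
    hx₀W ((Submodule.span_singleton_le_iff_mem w₀ W).mpr hw₀LW.2 h)
  -- the isotropic plane `N = span {w₀, x₀}`
  let N : Submodule K V := span K {w₀, x₀}
  have hN : ∀ x ∈ N, ∀ y ∈ N, B x y = 0 := by
    intro x hx y hy
    obtain ⟨a, b, rfl⟩ := Submodule.mem_span_pair.mp hx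
    obtain ⟨c, d, rfl⟩ := Submodule.mem_span_pair.mp hy
    simp only [map_add, map_smul, LinearMap.add_apply, LinearMap.smul_apply, smul_eq_mul,
      hW w₀ hw₀LW.2 w₀ hw₀LW.2, hL' x₀ hx₀L' x₀ hx₀L', hx₀w₀, hBs.eq w₀ x₀, mul_zero, add_zero]
  have hN2 : finrank K N = 2 := by
    classical
    -- `≤ 2`: spanned by two vectors; `> 1`: contains the line `K w₀` properly (`x₀ ∉ K w₀`)
    have hle : finrank K N ≤ 2 := by
      have h := finrank_span_finset_le_card (R := K) (M := V) ({w₀, x₀} : Finset V)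
      rw [Finset.coe_pair] at h
      exact h.trans Finset.card_le_two
    have hlt : (K ∙ w₀) < N :=
      lt_of_le_of_ne ((Submodule.span_singleton_le_iff_mem w₀ N).mpr
        (Submodule.subset_span (by simp))) fun h ↦
          hx₀w (h ▸ (Submodule.subset_span (by simp) : x₀ ∈ N))
    have hgt := Submodule.finrank_lt_finrank_of_lt hlt
    rw [finrank_span_singleton hw₀] at hgt
    omega
  -- three planes `L, W, N` through `w₀`
  have hNL : N = L := by
    rcases eq_or_eq_of_isotropic_of_mem B hB hBs h4 hL2 hW2 hN2 hL hW hN hw₀ hw₀LW.1 hw₀LW.2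
      (Submodule.subset_span (by simp)) hLneW with h | h
    · exact h
    · exact absurd (h ▸ (Submodule.subset_span (by simp) : x₀ ∈ N)) hx₀W
  have hx₀L : x₀ ∈ L := hNL ▸ (Submodule.subset_span (by simp) : x₀ ∈ N)
  -- `1 ≤ dim (L ⊓ L') < 2`
  haveI : Module.Finite K ↥(L ⊓ L') :=
    Module.Finite.of_injective (Submodule.inclusion (inf_le_right : L ⊓ L' ≤ L'))
      (Submodule.inclusion_injective _)
  have h1 : 1 ≤ finrank K ↥(L ⊓ L') := by
    have := Submodule.finrank_mono ((Submodule.span_singleton_le_iff_mem x₀ (L ⊓ L')).mpr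
      ⟨hx₀L, hx₀L'⟩)
    rwa [finrank_span_singleton hx₀0] at this
  have h2 : finrank K ↥(L ⊓ L') < 2 := by
    rw [← hL'2]
    refine Submodule.finrank_lt_finrank_of_lt (lt_of_le_of_ne inf_le_right fun h ↦ ?_)
    -- `L ⊓ L' = L'` gives `L' ≤ L`, `L' = L`, contradicting the traces on `W`
    have hL'L : L' = L := Submodule.eq_of_le_of_finrank_eq (inf_eq_right.mp h) (hL'2.trans hL2.symm)
    rw [hL'L] at hL'W
    rw [hL'W, finrank_bot] at hLW
    exact zero_ne_one hLW
  omega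

end Rulings

end Summit.BirchSwinnertonDyer.Rank1Residual.GaloisImage.ThreeLagrangian
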